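import Mathlib
import Summits.Ventures.FusionMHD.Models.SAlphaSecondStableS3A6PointPrep
import HarnessLib

/-!
# F3 row «F3.BALLOON-sα-SECOND-STABILITY-S3-A6»: at `(s, α) = (3, 6)` — ABOVE the unstable band at shear `3` — the `s–α` ballooning MODEL is on the STABLE SIDE again (`SAlpha.StableSide 3 6`): the first kernel-certified SECOND-STABILITY point; with ★ #228 (`(3, 8/5)` stable), ★ #192 / `SAlphaQuarticBumpShears.unstableWitness_tt_three_115` (`(3, 11/5)` unstable) and this file, the unstable `α`-set at `s = 3` is certified to be BOUNDED ABOVE somewhere in `(11/5, 6)` as well as below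

LADDER-GRIDFUSION rung F3 (cell `gridfusion`; DIRECTOR RULING 67 (5): «a second-stability-side theorem (stable again at large α at fixed s)»
is a row class outside the eight-shear cap).  Assembly by gridfusion-model-7 g9, 2026-08-28, in model-7 g8's multi-piece CORE LANE
(★ #209-line `SAlphaStableS2A1*` / `SAlphaStable58*`) of (i) TWELVE kernel-certified core amplitude pieces (positivity leaves of half-width 1/32 on [0, 3], 1/16 on [3, 18]; trig point values with 20 terms after 5 halvings since θ ≤ 18) `SAlphaSecondStableS3A6Core0…11`
(polynomials `G0…G11` on `[0,1/2] ∪ [1/2,1] ∪ [1,3/2] ∪ [3/2,7/4] ∪ [7/4,2] ∪ [2,5/2] ∪ [5/2,3] ∪ [3,4] ∪ [4,6] ∪ [6,10] ∪ [10,14] ∪ [14,18]`,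
Taylor-model POSITIVITY leaves deciding `F_k > 0` and `amplitudeResidual 3 6 F_k F_k″ ≤ 0` piece by piece; slacks `η_k = 0.0008 … 0.00135`
increasing to the right), and (ii) gridfusion-lit-4's engine `Literature/MathematicalPhysics/MHD/BallooningSAlphaStableSide.lean`
(`energyDominatesOn_of_amplitude`, `EnergyDominatesOn.glue`, the explicit tail `(1 − c/θ)(1 + (α/s²) cos θ/θ²)` with `energyDominatesOn_tail` /
`tail_logDeriv_le` at `(c, T) = (8, 18)` — side condition `tailBound 3 6 8 18 ≥ 0` by `norm_num` (at `α/s² = 2/3` and `α = 6` lit-4's tail majorant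
needs `T ≥ 18` for `c = 8`; the junction `c/(T(T−c)) + (α/s²)(T+2)/(T(T²−α/s²)) = 0.0467… ≤ F′(18)/F(18) = 0.0562…` exact) —, `stableSide_of_core_tail`).
The 28-statement program `ss36Prog` carries the shear (`Λ = 3t − 6 sin t`, `Λ′ = 3 − 6 cos t`); its top register is PROVED `= −amplitudeResidual 3 6 F F″`.
Junctions `1/2, 1, 3/2, 7/4, 2, 5/2, 3, 4, 6, 10, 14` and the tail junction `18` are exact-rational inequalities; `F₀′(0) = 0` exactly.  0 kit in the kernel
objects; no `native_decide`.

## THREE COLUMNS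
CERTIFIED: in the `s–α` ballooning MODEL (Freidberg (12.96)–(12.99), `Λ = sθ − α sin θ`, `θ₀ = 0`) at `(s, α) = (3, 6)`: for EVERY window
`[a, b]` and every trial function `X` differentiable on `[a, b]` with `X(a) = X(b) = 0` there is NO `SAlpha.UnstableWitness` (`stableSide_three_six`) —
the surface is on the stable side although it lies ABOVE the certified-unstable surfaces `(3, 19/10 … 11/5)` of the same shear (★ #192's
`SAlphaQuarticBumpShears.unstableWitness_tt_three_115`, the two-turn lens `SAlphaTwoTurnLens` at `s = 3`: `[11/5, 23/5]`… NOTE the lens certifies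
`α ≤ lensHi 3 = 23/5 = 4.6` unstable, so together: at shear `3` the MODEL's unstable set contains `[19/10…, 23/5]`-points and misses `8/5` (★ #228) and `6`
(this file) ⇒ the model's SECOND stability boundary at `s = 3` lies in the CLOSED interval `[23/5, 6]` — and in `[111/20, 6]` with model-7's second-edge witness `SAlphaPolyWitnessS3A555.unstableWitness_three_555` (`(3, 111/20)` unstable; its interval files `SAlphaPolyWitnessS3A52` / `SAlphaPolyWitnessS3A555B` make `U₃ ⊇ [19/10, 111/20]` one certified interval); monotonicity / connectedness of the unstable set in
`α` is NOT typed.  VALIDATED (not in the kernel): E–L shooting (model-7 g9 kit j304843, even and odd solutions, zero on `(0, 150]`) puts the second edge at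
`α ≈ 5.61` for `s = 3` (and `4.91` for `s = 5/2`); Freidberg Fig. 12.5 shows the second-stable region qualitatively; float Liouville amplitude:
`F′/F(18) ≈ 0.056`, `F(18) ≈ 132·F(0)` (the certified pieces give `G11(18)/G0(0) = 131.73`; `F(14) ≈ 101.7·F(0)` — ERRATUM 2026-08-28 g10 for ref-2 g20 w1, comment only), slack margins `E/((1+Λ²)²F) ≤ −η_k`.  MODELLED: `s–α` model (large-aspect-ratio shifted circles, high-`n`
ballooning ordering, `θ₀ = 0`, ideal MHD); «stable side» = the MODEL's one-surface functional admits no negative compactly supported trial function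
(lit-3's witness class); the representation step (Connor–Hastie–Taylor 1979) is quoted in the Literature file, not typed; in particular NOTHING is
claimed about `θ₀ ≠ 0` (the physical second-stability access question involves all `θ₀`), about a device, or about a `β`-limit.
Citations: Freidberg 2014 §12.3, §12.6.2 (12.96)–(12.100), Fig. 12.5 [Freidberg2014]; Hartman 2002 XI.6.2 [Hartman2002]; Makino–Berz 2003 Alg. 2
[MakinoBerz2003].  Everything below is [instance data].
-/

open Literature.Analysis.ValidatedNumerics Literature.Analysis.ValidatedNumerics.PolyMP
open Literature.Analysis.ValidatedNumerics.NumericsMP Literature.Analysis.ValidatedNumerics.ExpPoly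
open Literature.MathematicalPhysics.MHD.Ballooning
open Real Set

namespace Summit.Ventures.FusionMHD.Models

namespace SAlphaSecondStableS3A6

/-! (PART 2/2: the assembly; §1–§2 live in `SAlphaSecondStableS3A6PointPrep`.) -/

/-! ### §3 Assembly -/

/-- The glued core phase on `[0, 18]` dominates the energy. [instance data] -/
theorem ss36_dominates_core :
    SAlpha.EnergyDominatesOn 3 (6) (fun θ => if θ ≤ (14 : ℝ) then (if θ ≤ (10 : ℝ) then (if θ ≤ (6 : ℝ) then (if θ ≤ (4 : ℝ) then (if θ ≤ (3 : ℝ) then (if θ ≤ (5 / 2 : ℝ) then (if θ ≤ (2 : ℝ) then (if θ ≤ (7 / 4 : ℝ) then (if θ ≤ (3 / 2 : ℝ) then (if θ ≤ (1 : ℝ) then (if θ ≤ (1 / 2 : ℝ) then ((SAlpha.amplitudePhase 3 (6) (Poly.eval G0) (Poly.eval (Poly.deriv G0))) θ) else (SAlpha.amplitudePhase 3 (6) (Poly.eval G1) (Poly.eval (Poly.deriv G1))) θ) else (SAlpha.amplitudePhase 3 (6) (Poly.eval G2) (Poly.eval (Poly.deriv G2))) θ) else (SAlpha.amplitudePhase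 3 (6) (Poly.eval G3) (Poly.eval (Poly.deriv G3))) θ) else (SAlpha.amplitudePhase 3 (6) (Poly.eval G4) (Poly.eval (Poly.deriv G4))) θ) else (SAlpha.amplitudePhase 3 (6) (Poly.eval G5) (Poly.eval (Poly.deriv G5))) θ) else (SAlpha.amplitudePhase 3 (6) (Poly.eval G6) (Poly.eval (Poly.deriv G6))) θ) else (SAlpha.amplitudePhase 3 (6) (Poly.eval G7) (Poly.eval (Poly.deriv G7))) θ) else (SAlpha.amplitudePhase 3 (6) (Poly.eval G8) (Poly.eval (Poly.deriv G8))) θ) else (SAlpha.amplitudePhase 3 (6) (Poly.eval G9) (Poly.eval (Poly.deriv G9))) θ) else (SAlpha.amplitudePhase 3 (6) (Poly.eval G10) (Poly.eval (Poly.deriv G10))) θ) else (SAlpha.amplitudePhase 3 (6) (Poly.eval G11) (Poly.eval (Poly.deriv G11))) θ) (Icc 0 (18 : ℝ)) := by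
  have h0 := ss36_dominates0
  have h1 := ss36_dominates1
  have h2 := ss36_dominates2
  have h3 := ss36_dominates3
  have h4 := ss36_dominates4
  have h5 := ss36_dominates5
  have h6 := ss36_dominates6
  have h7 := ss36_dominates7
  have h8 := ss36_dominates8
  have h9 := ss36_dominates9
  have h10 := ss36_dominates10
  have h11 := ss36_dominates11
  have g1 : SAlpha.EnergyDominatesOn 3 (6) (fun θ => if θ ≤ (1 / 2 : ℝ) then ((SAlpha.amplitudePhase 3 (6) (Poly.eval G0) (Poly.eval (Poly.deriv G0))) θ) else (SAlpha.amplitudePhase 3 (6) (Poly.eval G1) (Poly.eval (Poly.deriv G1))) θ) (Icc 0 (1 : ℝ)) := by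
    refine SAlpha.EnergyDominatesOn.glue (h0.mono ?_) (h1.mono ?_) ?_
    · intro θ hθ; exact ⟨hθ.1.1, hθ.2⟩
    · intro θ hθ; exact ⟨hθ.2, hθ.1.2⟩
    · exact ss36_junction01
  have g2 : SAlpha.EnergyDominatesOn 3 (6) (fun θ => if θ ≤ (1 : ℝ) then (if θ ≤ (1 / 2 : ℝ) then ((SAlpha.amplitudePhase 3 (6) (Poly.eval G0) (Poly.eval (Poly.deriv G0))) θ) else (SAlpha.amplitudePhase 3 (6) (Poly.eval G1) (Poly.eval (Poly.deriv G1))) θ) else (SAlpha.amplitudePhase 3 (6) (Poly.eval G2) (Poly.eval (Poly.deriv G2))) θ) (Icc 0 (3 / 2 : ℝ)) := by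
    refine SAlpha.EnergyDominatesOn.glue (g1.mono ?_) (h2.mono ?_) ?_
    · intro θ hθ; exact ⟨hθ.1.1, hθ.2⟩
    · intro θ hθ; exact ⟨hθ.2, hθ.1.2⟩
    · have hn1 : ¬ ((1 : ℝ) ≤ (1 / 2 : ℝ)) := by norm_num
      simp only [hn1, if_false]
      exact ss36_junction12
  have g3 : SAlpha.EnergyDominatesOn 3 (6) (fun θ => if θ ≤ (3 / 2 : ℝ) then (if θ ≤ (1 : ℝ) then (if θ ≤ (1 / 2 : ℝ) then ((SAlpha.amplitudePhase 3 (6) (Poly.eval G0) (Poly.eval (Poly.deriv G0))) θ) else (SAlpha.amplitudePhase 3 (6) (Poly.eval G1) (Poly.eval (Poly.deriv G1))) θ) else (SAlpha.amplitudePhase 3 (6) (Poly.eval G2) (Poly.eval (Poly.deriv G2))) θ) else (SAlpha.amplitudePhase 3 (6) (Poly.eval G3) (Poly.eval (Poly.deriv G3))) θ) (Icc 0 (7 / 4 : ℝ)) := by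
    refine SAlpha.EnergyDominatesOn.glue (g2.mono ?_) (h3.mono ?_) ?_
    · intro θ hθ; exact ⟨hθ.1.1, hθ.2⟩
    · intro θ hθ; exact ⟨hθ.2, hθ.1.2⟩
    · have hn1 : ¬ ((3 / 2 : ℝ) ≤ (1 / 2 : ℝ)) := by norm_num
      have hn2 : ¬ ((3 / 2 : ℝ) ≤ (1 : ℝ)) := by norm_num
      simp only [hn1, hn2, if_false]
      exact ss36_junction23
  have g4 : SAlpha.EnergyDominatesOn 3 (6) (fun θ => if θ ≤ (7 / 4 : ℝ) then (if θ ≤ (3 / 2 : ℝ) then (if θ ≤ (1 : ℝ) then (if θ ≤ (1 / 2 : ℝ) then ((SAlpha.amplitudePhase 3 (6) (Poly.eval G0) (Poly.eval (Poly.deriv G0))) θ) else (SAlpha.amplitudePhase 3 (6) (Poly.eval G1) (Poly.eval (Poly.deriv G1))) θ) else (SAlpha.amplitudePhase 3 (6) (Poly.eval G2) (Poly.eval (Poly.deriv G2))) θ) else (SAlpha.amplitudePhase 3 (6) (Poly.eval G3) (Poly.eval (Poly.deriv G3))) θ) else (SAlpha.amplitudePhase 3 (6) (Poly.eval G4) (Poly.eval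 (Poly.deriv G4))) θ) (Icc 0 (2 : ℝ)) := by
    refine SAlpha.EnergyDominatesOn.glue (g3.mono ?_) (h4.mono ?_) ?_
    · intro θ hθ; exact ⟨hθ.1.1, hθ.2⟩
    · intro θ hθ; exact ⟨hθ.2, hθ.1.2⟩
    · have hn1 : ¬ ((7 / 4 : ℝ) ≤ (1 / 2 : ℝ)) := by norm_num
      have hn2 : ¬ ((7 / 4 : ℝ) ≤ (1 : ℝ)) := by norm_num
      have hn3 : ¬ ((7 / 4 : ℝ) ≤ (3 / 2 : ℝ)) := by norm_num
      simp only [hn1, hn2, hn3, if_false]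
      exact ss36_junction34
  have g5 : SAlpha.EnergyDominatesOn 3 (6) (fun θ => if θ ≤ (2 : ℝ) then (if θ ≤ (7 / 4 : ℝ) then (if θ ≤ (3 / 2 : ℝ) then (if θ ≤ (1 : ℝ) then (if θ ≤ (1 / 2 : ℝ) then ((SAlpha.amplitudePhase 3 (6) (Poly.eval G0) (Poly.eval (Poly.deriv G0))) θ) else (SAlpha.amplitudePhase 3 (6) (Poly.eval G1) (Poly.eval (Poly.deriv G1))) θ) else (SAlpha.amplitudePhase 3 (6) (Poly.eval G2) (Poly.eval (Poly.deriv G2))) θ) else (SAlpha.amplitudePhase 3 (6) (Poly.eval G3) (Poly.eval (Poly.deriv G3))) θ) else (SAlpha.amplitudePhase 3 (6) (Poly.eval G4) (Poly.eval (Poly.deriv G4))) θ) else (SAlpha.amplitudePhase 3 (6) (Poly.eval G5) (Poly.eval (Poly.deriv G5))) θ) (Icc 0 (5 / 2 : ℝ)) := by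
    refine SAlpha.EnergyDominatesOn.glue (g4.mono ?_) (h5.mono ?_) ?_
    · intro θ hθ; exact ⟨hθ.1.1, hθ.2⟩
    · intro θ hθ; exact ⟨hθ.2, hθ.1.2⟩
    · have hn1 : ¬ ((2 : ℝ) ≤ (1 / 2 : ℝ)) := by norm_num
      have hn2 : ¬ ((2 : ℝ) ≤ (1 : ℝ)) := by norm_num
      have hn3 : ¬ ((2 : ℝ) ≤ (3 / 2 : ℝ)) := by norm_num
      have hn4 : ¬ ((2 : ℝ) ≤ (7 / 4 : ℝ)) := by norm_num
      simp only [hn1, hn2, hn3, hn4, if_false]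
      exact ss36_junction45
  have g6 : SAlpha.EnergyDominatesOn 3 (6) (fun θ => if θ ≤ (5 / 2 : ℝ) then (if θ ≤ (2 : ℝ) then (if θ ≤ (7 / 4 : ℝ) then (if θ ≤ (3 / 2 : ℝ) then (if θ ≤ (1 : ℝ) then (if θ ≤ (1 / 2 : ℝ) then ((SAlpha.amplitudePhase 3 (6) (Poly.eval G0) (Poly.eval (Poly.deriv G0))) θ) else (SAlpha.amplitudePhase 3 (6) (Poly.eval G1) (Poly.eval (Poly.deriv G1))) θ) else (SAlpha.amplitudePhase 3 (6) (Poly.eval G2) (Poly.eval (Poly.deriv G2))) θ) else (SAlpha.amplitudePhase 3 (6) (Poly.eval G3) (Poly.eval (Poly.deriv G3))) θ) else (SAlpha.amplitudePhase 3 (6) (Poly.eval G4) (Poly.eval (Poly.deriv G4))) θ) else (SAlpha.amplitudePhase 3 (6) (Poly.eval G5) (Poly.eval (Poly.deriv G5))) θ) else (SAlpha.amplitudePhase 3 (6) (Poly.eval G6) (Poly.eval (Poly.deriv G6))) θ) (Icc 0 (3 : ℝ)) := by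
    refine SAlpha.EnergyDominatesOn.glue (g5.mono ?_) (h6.mono ?_) ?_
    · intro θ hθ; exact ⟨hθ.1.1, hθ.2⟩
    · intro θ hθ; exact ⟨hθ.2, hθ.1.2⟩
    · have hn1 : ¬ ((5 / 2 : ℝ) ≤ (1 / 2 : ℝ)) := by norm_num
      have hn2 : ¬ ((5 / 2 : ℝ) ≤ (1 : ℝ)) := by norm_num
      have hn3 : ¬ ((5 / 2 : ℝ) ≤ (3 / 2 : ℝ)) := by norm_num
      have hn4 : ¬ ((5 / 2 : ℝ) ≤ (7 / 4 : ℝ)) := by norm_num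
      have hn5 : ¬ ((5 / 2 : ℝ) ≤ (2 : ℝ)) := by norm_num
      simp only [hn1, hn2, hn3, hn4, hn5, if_false]
      exact ss36_junction56
  have g7 : SAlpha.EnergyDominatesOn 3 (6) (fun θ => if θ ≤ (3 : ℝ) then (if θ ≤ (5 / 2 : ℝ) then (if θ ≤ (2 : ℝ) then (if θ ≤ (7 / 4 : ℝ) then (if θ ≤ (3 / 2 : ℝ) then (if θ ≤ (1 : ℝ) then (if θ ≤ (1 / 2 : ℝ) then ((SAlpha.amplitudePhase 3 (6) (Poly.eval G0) (Poly.eval (Poly.deriv G0))) θ) else (SAlpha.amplitudePhase 3 (6) (Poly.eval G1) (Poly.eval (Poly.deriv G1))) θ) else (SAlpha.amplitudePhase 3 (6) (Poly.eval G2) (Poly.eval (Poly.deriv G2))) θ) else (SAlpha.amplitudePhase 3 (6) (Poly.eval G3) (Poly.eval (Poly.deriv G3))) θ) else (SAlpha.amplitudePhase 3 (6) (Poly.eval G4) (Poly.eval (Poly.deriv G4))) θ) else (SAlpha.amplitudePhase 3 (6) (Poly.eval G5) (Poly.eval (Poly.deriv G5))) θ) else (SAlpha.amplitudePhase 3 (6)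 (Poly.eval G6) (Poly.eval (Poly.deriv G6))) θ) else (SAlpha.amplitudePhase 3 (6) (Poly.eval G7) (Poly.eval (Poly.deriv G7))) θ) (Icc 0 (4 : ℝ)) := by
    refine SAlpha.EnergyDominatesOn.glue (g6.mono ?_) (h7.mono ?_) ?_
    · intro θ hθ; exact ⟨hθ.1.1, hθ.2⟩
    · intro θ hθ; exact ⟨hθ.2, hθ.1.2⟩
    · have hn1 : ¬ ((3 : ℝ) ≤ (1 / 2 : ℝ)) := by norm_num
      have hn2 : ¬ ((3 : ℝ) ≤ (1 : ℝ)) := by norm_num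
      have hn3 : ¬ ((3 : ℝ) ≤ (3 / 2 : ℝ)) := by norm_num
      have hn4 : ¬ ((3 : ℝ) ≤ (7 / 4 : ℝ)) := by norm_num
      have hn5 : ¬ ((3 : ℝ) ≤ (2 : ℝ)) := by norm_num
      have hn6 : ¬ ((3 : ℝ) ≤ (5 / 2 : ℝ)) := by norm_num
      simp only [hn1, hn2, hn3, hn4, hn5, hn6, if_false]
      exact ss36_junction67
  have g8 : SAlpha.EnergyDominatesOn 3 (6) (fun θ => if θ ≤ (4 : ℝ) then (if θ ≤ (3 : ℝ) then (if θ ≤ (5 / 2 : ℝ) then (if θ ≤ (2 : ℝ) then (if θ ≤ (7 / 4 : ℝ) then (if θ ≤ (3 / 2 : ℝ) then (if θ ≤ (1 : ℝ) then (if θ ≤ (1 / 2 : ℝ) then ((SAlpha.amplitudePhase 3 (6) (Poly.eval G0) (Poly.eval (Poly.deriv G0))) θ) else (SAlpha.amplitudePhase 3 (6) (Poly.eval G1) (Poly.eval (Poly.deriv G1))) θ) else (SAlpha.amplitudePhase 3 (6) (Poly.eval G2) (Poly.eval (Poly.deriv G2))) θ) else (SAlpha.amplitudePhase 3 (6) (Poly.eval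 G3) (Poly.eval (Poly.deriv G3))) θ) else (SAlpha.amplitudePhase 3 (6) (Poly.eval G4) (Poly.eval (Poly.deriv G4))) θ) else (SAlpha.amplitudePhase 3 (6) (Poly.eval G5) (Poly.eval (Poly.deriv G5))) θ) else (SAlpha.amplitudePhase 3 (6) (Poly.eval G6) (Poly.eval (Poly.deriv G6))) θ) else (SAlpha.amplitudePhase 3 (6) (Poly.eval G7) (Poly.eval (Poly.deriv G7))) θ) else (SAlpha.amplitudePhase 3 (6) (Poly.eval G8) (Poly.eval (Poly.deriv G8))) θ) (Icc 0 (6 : ℝ)) := by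
    refine SAlpha.EnergyDominatesOn.glue (g7.mono ?_) (h8.mono ?_) ?_
    · intro θ hθ; exact ⟨hθ.1.1, hθ.2⟩
    · intro θ hθ; exact ⟨hθ.2, hθ.1.2⟩
    · have hn1 : ¬ ((4 : ℝ) ≤ (1 / 2 : ℝ)) := by norm_num
      have hn2 : ¬ ((4 : ℝ) ≤ (1 : ℝ)) := by norm_num
      have hn3 : ¬ ((4 : ℝ) ≤ (3 / 2 : ℝ)) := by norm_num
      have hn4 : ¬ ((4 : ℝ) ≤ (7 / 4 : ℝ)) := by norm_num
      have hn5 : ¬ ((4 : ℝ) ≤ (2 : ℝ)) := by norm_num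
      have hn6 : ¬ ((4 : ℝ) ≤ (5 / 2 : ℝ)) := by norm_num
      have hn7 : ¬ ((4 : ℝ) ≤ (3 : ℝ)) := by norm_num
      simp only [hn1, hn2, hn3, hn4, hn5, hn6, hn7, if_false]
      exact ss36_junction78
  have g9 : SAlpha.EnergyDominatesOn 3 (6) (fun θ => if θ ≤ (6 : ℝ) then (if θ ≤ (4 : ℝ) then (if θ ≤ (3 : ℝ) then (if θ ≤ (5 / 2 : ℝ) then (if θ ≤ (2 : ℝ) then (if θ ≤ (7 / 4 : ℝ) then (if θ ≤ (3 / 2 : ℝ) then (if θ ≤ (1 : ℝ) then (if θ ≤ (1 / 2 : ℝ) then ((SAlpha.amplitudePhase 3 (6) (Poly.eval G0) (Poly.eval (Poly.deriv G0))) θ) else (SAlpha.amplitudePhase 3 (6) (Poly.eval G1) (Poly.eval (Poly.deriv G1))) θ) else (SAlpha.amplitudePhase 3 (6) (Poly.eval G2) (Poly.eval (Poly.deriv G2))) θ) else (SAlpha.amplitudePhase 3 (6) (Poly.eval G3) (Poly.eval (Poly.deriv G3))) θ) else (SAlpha.amplitudePhase 3 (6) (Poly.eval G4) (Poly.eval (Poly.deriv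 G4))) θ) else (SAlpha.amplitudePhase 3 (6) (Poly.eval G5) (Poly.eval (Poly.deriv G5))) θ) else (SAlpha.amplitudePhase 3 (6) (Poly.eval G6) (Poly.eval (Poly.deriv G6))) θ) else (SAlpha.amplitudePhase 3 (6) (Poly.eval G7) (Poly.eval (Poly.deriv G7))) θ) else (SAlpha.amplitudePhase 3 (6) (Poly.eval G8) (Poly.eval (Poly.deriv G8))) θ) else (SAlpha.amplitudePhase 3 (6) (Poly.eval G9) (Poly.eval (Poly.deriv G9))) θ) (Icc 0 (10 : ℝ)) := by
    refine SAlpha.EnergyDominatesOn.glue (g8.mono ?_) (h9.mono ?_) ?_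
    · intro θ hθ; exact ⟨hθ.1.1, hθ.2⟩
    · intro θ hθ; exact ⟨hθ.2, hθ.1.2⟩
    · have hn1 : ¬ ((6 : ℝ) ≤ (1 / 2 : ℝ)) := by norm_num
      have hn2 : ¬ ((6 : ℝ) ≤ (1 : ℝ)) := by norm_num
      have hn3 : ¬ ((6 : ℝ) ≤ (3 / 2 : ℝ)) := by norm_num
      have hn4 : ¬ ((6 : ℝ) ≤ (7 / 4 : ℝ)) := by norm_num
      have hn5 : ¬ ((6 : ℝ) ≤ (2 : ℝ)) := by norm_num
      have hn6 : ¬ ((6 : ℝ) ≤ (5 / 2 : ℝ)) := by norm_num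
      have hn7 : ¬ ((6 : ℝ) ≤ (3 : ℝ)) := by norm_num
      have hn8 : ¬ ((6 : ℝ) ≤ (4 : ℝ)) := by norm_num
      simp only [hn1, hn2, hn3, hn4, hn5, hn6, hn7, hn8, if_false]
      exact ss36_junction89
  have g10 : SAlpha.EnergyDominatesOn 3 (6) (fun θ => if θ ≤ (10 : ℝ) then (if θ ≤ (6 : ℝ) then (if θ ≤ (4 : ℝ) then (if θ ≤ (3 : ℝ) then (if θ ≤ (5 / 2 : ℝ) then (if θ ≤ (2 : ℝ) then (if θ ≤ (7 / 4 : ℝ) then (if θ ≤ (3 / 2 : ℝ) then (if θ ≤ (1 : ℝ) then (if θ ≤ (1 / 2 : ℝ) then ((SAlpha.amplitudePhase 3 (6) (Poly.eval G0) (Poly.eval (Poly.deriv G0))) θ) else (SAlpha.amplitudePhase 3 (6) (Poly.eval G1) (Poly.eval (Poly.deriv G1))) θ) else (SAlpha.amplitudePhase 3 (6) (Poly.eval G2) (Poly.eval (Poly.deriv G2))) θ) else (SAlpha.amplitudePhase 3 (6) (Poly.eval G3) (Poly.eval (Poly.deriv G3))) θ) else (SAlpha.amplitudePhase 3 (6)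 (Poly.eval G4) (Poly.eval (Poly.deriv G4))) θ) else (SAlpha.amplitudePhase 3 (6) (Poly.eval G5) (Poly.eval (Poly.deriv G5))) θ) else (SAlpha.amplitudePhase 3 (6) (Poly.eval G6) (Poly.eval (Poly.deriv G6))) θ) else (SAlpha.amplitudePhase 3 (6) (Poly.eval G7) (Poly.eval (Poly.deriv G7))) θ) else (SAlpha.amplitudePhase 3 (6) (Poly.eval G8) (Poly.eval (Poly.deriv G8))) θ) else (SAlpha.amplitudePhase 3 (6) (Poly.eval G9) (Poly.eval (Poly.deriv G9))) θ) else (SAlpha.amplitudePhase 3 (6) (Poly.eval G10) (Poly.eval (Poly.deriv G10))) θ) (Icc 0 (14 : ℝ)) := by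
    refine SAlpha.EnergyDominatesOn.glue (g9.mono ?_) (h10.mono ?_) ?_
    · intro θ hθ; exact ⟨hθ.1.1, hθ.2⟩
    · intro θ hθ; exact ⟨hθ.2, hθ.1.2⟩
    · have hn1 : ¬ ((10 : ℝ) ≤ (1 / 2 : ℝ)) := by norm_num
      have hn2 : ¬ ((10 : ℝ) ≤ (1 : ℝ)) := by norm_num
      have hn3 : ¬ ((10 : ℝ) ≤ (3 / 2 : ℝ)) := by norm_num
      have hn4 : ¬ ((10 : ℝ) ≤ (7 / 4 : ℝ)) := by norm_num
      have hn5 : ¬ ((10 : ℝ) ≤ (2 : ℝ)) := by norm_num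
      have hn6 : ¬ ((10 : ℝ) ≤ (5 / 2 : ℝ)) := by norm_num
      have hn7 : ¬ ((10 : ℝ) ≤ (3 : ℝ)) := by norm_num
      have hn8 : ¬ ((10 : ℝ) ≤ (4 : ℝ)) := by norm_num
      have hn9 : ¬ ((10 : ℝ) ≤ (6 : ℝ)) := by norm_num
      simp only [hn1, hn2, hn3, hn4, hn5, hn6, hn7, hn8, hn9, if_false]
      exact ss36_junction910
  refine SAlpha.EnergyDominatesOn.glue (g10.mono ?_) (h11.mono ?_) ?_
  · intro θ hθ; exact ⟨hθ.1.1, hθ.2⟩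
  · intro θ hθ; exact ⟨hθ.2, hθ.1.2⟩
  · have hn1 : ¬ ((14 : ℝ) ≤ (1 / 2 : ℝ)) := by norm_num
    have hn2 : ¬ ((14 : ℝ) ≤ (1 : ℝ)) := by norm_num
    have hn3 : ¬ ((14 : ℝ) ≤ (3 / 2 : ℝ)) := by norm_num
    have hn4 : ¬ ((14 : ℝ) ≤ (7 / 4 : ℝ)) := by norm_num
    have hn5 : ¬ ((14 : ℝ) ≤ (2 : ℝ)) := by norm_num
    have hn6 : ¬ ((14 : ℝ) ≤ (5 / 2 : ℝ)) := by norm_num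
    have hn7 : ¬ ((14 : ℝ) ≤ (3 : ℝ)) := by norm_num
    have hn8 : ¬ ((14 : ℝ) ≤ (4 : ℝ)) := by norm_num
    have hn9 : ¬ ((14 : ℝ) ≤ (6 : ℝ)) := by norm_num
    have hn10 : ¬ ((14 : ℝ) ≤ (10 : ℝ)) := by norm_num
    simp only [hn1, hn2, hn3, hn4, hn5, hn6, hn7, hn8, hn9, hn10, if_false]
    exact ss36_junction1011

/-- **THE ROW: `(s, α) = (3, 6)` IS ON THE STABLE SIDE OF THE `s–α` MODEL** — no window carries an `SAlpha.UnstableWitness`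
(glued polynomial core on `[−18, 18]` by reflection, lit-4's explicit tail amplitude `(1 − c/θ)(1 + α cos θ/θ²)`, `c = 8`, beyond).
MODEL `s–α`; «stable» in the model's own one-surface (Newcomb) sense; nothing about a device. [instance data] -/
theorem stableSide_three_six : SAlpha.StableSide 3 (6) := by
  have hcore := ss36_dominates_core
  have htail := SAlpha.energyDominatesOn_tail (s := 3) (α := 6) (c := 8) (T := 18)
    (by norm_num) (by norm_num) (by norm_num) (by norm_num) (by norm_num) ss36_tailBound_nonneg
  refine SAlpha.stableSide_of_core_tail (by norm_num) hcore ?_ htail ?_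
  · simp only [show ((0:ℝ) ≤ (1 / 2 : ℝ)) from by norm_num, show ((0:ℝ) ≤ (1 : ℝ)) from by norm_num, show ((0:ℝ) ≤ (3 / 2 : ℝ)) from by norm_num, show ((0:ℝ) ≤ (7 / 4 : ℝ)) from by norm_num, show ((0:ℝ) ≤ (2 : ℝ)) from by norm_num, show ((0:ℝ) ≤ (5 / 2 : ℝ)) from by norm_num, show ((0:ℝ) ≤ (3 : ℝ)) from by norm_num, show ((0:ℝ) ≤ (4 : ℝ)) from by norm_num, show ((0:ℝ) ≤ (6 : ℝ)) from by norm_num, show ((0:ℝ) ≤ (10 : ℝ)) from by norm_num, show ((0:ℝ) ≤ (14 : ℝ)) from by norm_num, if_true]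
    exact (SAlpha.amplitudePhase_zero_of_deriv_zero G0d_at_zero).le
  · have ht0 : ¬ ((18 : ℝ) ≤ (1 / 2 : ℝ)) := by norm_num
    have ht1 : ¬ ((18 : ℝ) ≤ (1 : ℝ)) := by norm_num
    have ht2 : ¬ ((18 : ℝ) ≤ (3 / 2 : ℝ)) := by norm_num
    have ht3 : ¬ ((18 : ℝ) ≤ (7 / 4 : ℝ)) := by norm_num
    have ht4 : ¬ ((18 : ℝ) ≤ (2 : ℝ)) := by norm_num
    have ht5 : ¬ ((18 : ℝ) ≤ (5 / 2 : ℝ)) := by norm_num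
    have ht6 : ¬ ((18 : ℝ) ≤ (3 : ℝ)) := by norm_num
    have ht7 : ¬ ((18 : ℝ) ≤ (4 : ℝ)) := by norm_num
    have ht8 : ¬ ((18 : ℝ) ≤ (6 : ℝ)) := by norm_num
    have ht9 : ¬ ((18 : ℝ) ≤ (10 : ℝ)) := by norm_num
    have ht10 : ¬ ((18 : ℝ) ≤ (14 : ℝ)) := by norm_num
    simp only [ht0, ht1, ht2, ht3, ht4, ht5, ht6, ht7, ht8, ht9, ht10, if_false]
    rw [SAlpha.amplitudePhase_le_iff]
    exact (SAlpha.tail_logDeriv_le (s := 3) (α := 6) (c := 8) (T := 18)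
      (by norm_num) (by norm_num) (by norm_num) (by norm_num) (by norm_num)).trans ss36_junction_tail

/-- Corollary in lit-3's words: at `(s, α) = (3, 6)` there is no `SAlpha.UnstableWitness` on ANY window. [instance data] -/
theorem not_unstableWitness_three_six (a b : ℝ) (X X' : ℝ → ℝ) :
    ¬ SAlpha.UnstableWitness 3 (6) a b X X' :=
  stableSide_three_six a b X X'

end SAlphaSecondStableS3A6

end Summit.Ventures.FusionMHD.Models
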